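import Literature.AlgebraicGeometry.Resolution.DecompletionPolydiscAlgebra
import Literature.AlgebraicGeometry.Resolution.DecompletionPolydiscData
import Literature.AlgebraicGeometry.Resolution.DecompletionEtalePair
import Mathlib.RingTheory.Flat.Stability
import Mathlib.Tactic.LinearCombination
import HarnessLib

/-!
# Temkin's decompletion lemma, algebraic proof — IX. The `m°`-polydisc chart `E₀`

Topic: `Literature/AlgebraicGeometry/Resolution`. M. Temkin, *Inseparable local uniformization*,
J. Algebra 373 (2013) 65–119 = arXiv:0804.1554v3, Lemma 3.3.2 (tree: `Temkin2013_Lemma332_nft`).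

The `m`-side half of the common smooth roof: from the integral data of the chart
(`DecompletionPolydiscData.lean`) and the Newton-normalized polynomials
(`DecompletionPolydiscAlgebra.lean`) we build, for parameters `ε = (r, j_z, U, …)`
(`DecompChart.EParams`), the explicit étale `m°[X₁,…,X_n]`-algebra

  `E₀ = (m°[X][W]/(F̃))[1/(F̃′ · (F̃ − F̃₀)/W · Ğ · ∏_{z ∈ U} Ž_z)]`,

smooth over `m°` — the finite-level form of the `m̂°`-polydisc `𝔛′_η ∩ Y` of Temkin's proof
(p. 45) — together with:

* its `m°`-point `σE` (`u′ ↦ 0`, `W ↦ 0`; all built-in localized factors have value `1` or a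
  unit) and the prime `rE` — PROVED;
* the ambient ring `ΩE = E₀ ⊗_{m°} m` (`ιE` injective by flatness) and the `K`-side map
  `ψE : Rh → ΩE` (`k[X]`-algebra map through the standard étale presentation of `Rh`,
  `Tᵢ ↦ π^{j_z} u′ᵢ`, `w ↦ x_E`; `hasMap_xE` via the evaluation chain `aeval_w'E_map`) — PROVED;
* **honest preimages** `zE z = Ž_z(W)·Ğ(W)^{−N_z} ∈ E₀` of `ψE(z)` for `z ∈ Rh` with
  `z(x) ∈ m°`, `b_z ≤ r` (`ιE_zE`), with the exact value `σE(zE z) = z(x)` (`σE_zE`) and the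
  smallness `zE z ∈ z(x) + π^M E₀`, `M = j_z − r − 2N₀` (`zE_small`, from `W_small`) — PROVED.

All statements are [folklore]; no named facts.

## Sources

* M. Temkin, arXiv:0804.1554v3, proof of Lemma 3.3.2 (pp. 45–46).
-/

noncomputable section

open Polynomial

namespace Literature.AlgebraicGeometry.Resolution

universe u

variable {k K m : Type u} [Field k] [Field K] [Algebra k K] [Field m] [Algebra k m]

/-! ## The `m°`-polydisc chart `E₀` -/

namespace DecompChart

variable {V : ValuationSubring k} {O : ValuationSubring m} {A : Subring K}
  {φ : Algebra.adjoin k (A : Set K) →ₐ[k] m} (C : DecompChart V O A φ)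

/-! ### Constants in `m°` -/

/-- `π ∈ m°`. [folklore] -/
def πO : O := C.vO ⟨C.π, C.hπV⟩

/-- `(πO : m) = π`. [folklore] -/
@[simp] theorem coe_πO : (C.πO : m) = algebraMap k m C.π := rfl

/-- `πO ≠ 0`. [folklore] -/
theorem πO_ne_zero : C.πO ≠ 0 := fun h => by
  have := congrArg Subtype.val h
  rw [coe_πO, ZeroMemClass.coe_zero, map_eq_zero] at this
  exact C.hπ0 this

/-- Powers of `πO` are non-zero-divisors of the domain `m°`. [folklore] -/
theorem pow_πO_mul_eq_zero {N : ℕ} {x : O} (h : C.πO ^ N * x = 0) : x = 0 :=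
  (mul_eq_zero.mp h).resolve_left (pow_ne_zero _ C.πO_ne_zero)

/-- `ι₀ ∈ m°`. [folklore] -/
def ι₀O : O := ⟨C.ι₀, mem_of_isIntegral_map V O C.hOV C.ι₀_isIntegral⟩

/-- `κ₀ ∈ m°`. [folklore] -/
def κ₀O : O := ⟨C.κ₀, mem_of_isIntegral_map V O C.hOV C.κ₀_isIntegral⟩

/-- `(ι₀O : m) = ι₀`. [folklore] -/
@[simp] theorem coe_ι₀O : (C.ι₀O : m) = C.ι₀ := rfl

/-- `(κ₀O : m) = κ₀`. [folklore] -/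
@[simp] theorem coe_κ₀O : (C.κ₀O : m) = C.κ₀ := rfl

/-- `c₀′ ι₀ = π^{N₀}` in `m°`. [folklore] -/
theorem c₀'_mul_ι₀O : C.c₀' * C.ι₀O = C.πO ^ C.N₀ :=
  Subtype.ext (by simp [ι₀O, C.c₀'_mul_ι₀])

/-- `g₀′ κ₀ = π^{N_g}` in `m°`. [folklore] -/
theorem g₀'_mul_κ₀O : C.g₀' * C.κ₀O = C.πO ^ C.Ng :=
  Subtype.ext (by simp [κ₀O, C.g₀'_mul_κ₀])

/-- `κ₀O ≠ 0`. [folklore] -/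
theorem κ₀O_ne_zero : C.κ₀O ≠ 0 := fun h => by
  have h1 := C.g₀'_mul_κ₀O
  rw [h, mul_zero] at h1
  exact pow_ne_zero _ C.πO_ne_zero h1.symm

/-! ### Parameters of the polydisc chart -/

/-- The parameters of an `m°`-polydisc chart: the Newton zoom `r`, the polydisc zoom `j_z`, and a
finite list `U` of elements of `Rh` whose images are to be units of the chart (their values at
the point are units of `m°`), subject to `b_z ≤ r` for `z ∈ U`, `N_g ≤ r`, `r + 2N₀ ≤ j_z`.
[folklore] -/
structure EParams where
  /-- the Newton zoom exponent -/
  r : ℕ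
  /-- the polydisc zoom exponent -/
  jz : ℕ
  /-- built-in units -/
  U : List C.Rh
  hUO : ∀ z ∈ U, C.φh z ∈ O
  hUunit : ∀ z (hz : z ∈ U), IsUnit (⟨C.φh z, hUO z hz⟩ : O)
  hUr : ∀ z ∈ U, C.repb z ≤ r
  hNg : C.Ng ≤ r
  hjz : r + 2 * C.N₀ ≤ jz

variable (ε : C.EParams)

/-- The smallness exponent `M = j_z − r − 2N₀` of the chart. [folklore] -/
def EParams.M : ℕ := ε.jz - ε.r - 2 * C.N₀

/-! ### The chart polynomials over `m°[X₁, …, X_n]` -/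

/-- `F̃`. [folklore] -/
def Ft : (MvPolynomial (Fin C.n) O)[X] :=
  Polydisc.Ftilde C.FO C.w₀'O C.πO C.c₀' C.ι₀O C.N₀ ε.r ε.jz

/-- `Ğ`. [folklore] -/
def Gt : (MvPolynomial (Fin C.n) O)[X] :=
  Polydisc.Ztilde C.GO C.w₀'O C.πO C.c₀' ε.r ε.jz C.κ₀O 1 C.Ng

/-- `Ž_z` for `z ∈ Rh` with `z(x) ∈ m°`. [folklore] -/
def Zt (z : C.Rh) (hz : C.φh z ∈ O) : (MvPolynomial (Fin C.n) O)[X] :=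
  Polydisc.Ztilde (C.repΦO z) C.w₀'O C.πO C.c₀' ε.r ε.jz
    (C.κ₀O ^ C.repN z * C.πO ^ (C.repN z * C.aG)) ⟨C.φh z, hz⟩ (C.repb z)

/-- The product of the `Ž_z`, `z ∈ U`. [folklore] -/
def gU : (MvPolynomial (Fin C.n) O)[X] :=
  (ε.U.attach.map fun z => C.Zt ε z.1 (ε.hUO z.1 z.2)).prod

/-- The linear substitution `w₀′ + c₀′π^r W`. [folklore] -/
def lin : (MvPolynomial (Fin C.n) O)[X] :=
  Polynomial.C (MvPolynomial.C C.w₀'O) + Polynomial.C (MvPolynomial.C (C.c₀' * C.πO ^ ε.r)) * X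

/-- `F̃` spec: `C(c₀′² π^r) F̃ = F_O(π^{j_z}X, w₀′ + c₀′π^r W)`. [folklore] -/
theorem Ft_spec : Polynomial.C (MvPolynomial.C (C.c₀' ^ 2 * C.πO ^ ε.r)) * C.Ft ε =
    (Polydisc.zpoly (C.πO ^ ε.jz) C.FO).comp (C.lin ε) :=
  Polydisc.Ftilde_spec C.FO C.w₀'O C.πO C.c₀' C.ι₀O C.N₀ ε.r ε.jz C.c₀'_mul_ι₀O C.pointVal_FO rfl
    ε.hjz

/-- `Ğ` spec: `C(π^{N_g}) Ğ = C κ₀ · G_O(π^{j_z}X, w₀′ + c₀′π^r W)`. [folklore] -/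
theorem Gt_spec : Polynomial.C (MvPolynomial.C (C.πO ^ C.Ng)) * C.Gt ε =
    Polynomial.C (MvPolynomial.C C.κ₀O) * (Polydisc.zpoly (C.πO ^ ε.jz) C.GO).comp (C.lin ε) :=
  Polydisc.Ztilde_spec C.GO C.w₀'O C.πO C.c₀' ε.r ε.jz C.κ₀O 1 C.Ng
    (by rw [mul_one]; exact C.g₀'_mul_κ₀O) (le_trans (le_trans ε.hNg (Nat.le_add_right _ _)) ε.hjz)
    ε.hNg

/-- `Ž_z` spec: `C(π^{b_z}) Ž_z = C(κ₀^N π^{N a_G}) · Φ_{z,O}(π^{j_z}X, w₀′ + c₀′π^r W)`, for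
`b_z ≤ r`. [folklore] -/
theorem Zt_spec (z : C.Rh) (hz : C.φh z ∈ O) (hb : C.repb z ≤ ε.r) :
    Polynomial.C (MvPolynomial.C (C.πO ^ C.repb z)) * C.Zt ε z hz =
    Polynomial.C (MvPolynomial.C (C.κ₀O ^ C.repN z * C.πO ^ (C.repN z * C.aG))) *
      (Polydisc.zpoly (C.πO ^ ε.jz) (C.repΦO z)).comp (C.lin ε) := by
  refine Polydisc.Ztilde_spec (C.repΦO z) C.w₀'O C.πO C.c₀' ε.r ε.jz _ _ _ ?_
    (le_trans (le_trans hb (Nat.le_add_right _ _)) ε.hjz) hb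
  apply Subtype.ext
  simp only [κ₀O]
  exact C.pointVal_repΦO_mul z

/-! ### The étale pair and the chart -/

/-- **The étale pair of the polydisc chart**: `(F̃, F̃′ · (F̃ − F̃(0))/W · Ğ · ∏_{z ∈ U} Ž_z)`.
[folklore] -/
def PE : EtalePair (MvPolynomial (Fin C.n) O) :=
  EtalePair.ofDerivativeMul (C.Ft ε) ((C.Ft ε).divX * C.Gt ε * C.gU ε)

/-- **The `m°`-polydisc chart** `E₀ = (m°[X][W]/(F̃))[1/(F̃′ · (F̃ − F̃₀)/W · Ğ · ∏ Ž_z)]` — étale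
over `m°[X₁, …, X_n]`, smooth over `m°` (the finite-level form of the `m̂°`-polydisc
`𝔛′_η ∩ Y` of Temkin's proof, p. 45). [folklore] -/
abbrev E₀ : Type u := (C.PE ε).Ring

/-- `E₀` as an `m°`-algebra. [folklore] -/
instance algebraOE₀ : Algebra O (C.E₀ ε) :=
  ((algebraMap (MvPolynomial (Fin C.n) O) (C.E₀ ε)).comp
    (algebraMap O (MvPolynomial (Fin C.n) O))).toAlgebra

/-- The tower `m° → m°[X] → E₀`. [folklore] -/
instance isScalarTower_E₀ : IsScalarTower O (MvPolynomial (Fin C.n) O) (C.E₀ ε) :=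
  IsScalarTower.of_algebraMap_eq fun _ => rfl

/-- **`E₀` is smooth over `m°`** (`m°[X]` is smooth over `m°`, `E₀` is étale over `m°[X]`). [folklore] -/
instance smooth_E₀ : Algebra.Smooth O (C.E₀ ε) :=
  haveI : Algebra.Smooth O (MvPolynomial (Fin C.n) O) := Algebra.Smooth.mk
  Algebra.Smooth.comp O (MvPolynomial (Fin C.n) O) (C.E₀ ε)

/-- `E₀` is flat over `m°`. [folklore] -/
instance flat_E₀ : Module.Flat O (C.E₀ ε) :=
  Module.Flat.trans O (MvPolynomial (Fin C.n) O) (C.E₀ ε)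

/-- The Newton variable `W ∈ E₀`. [folklore] -/
abbrev W : C.E₀ ε := (C.PE ε).X

/-- `m°[X] → E₀` applied to a polynomial `Ψ(π^{j_z}X, w₀′ + c₀′π^rW)`: the evaluation
`evalE Ψ = Ψ(π^{j_z} u′, w₀′ + c₀′π^r W) ∈ E₀`. [folklore] -/
def evalE (Ψ : (MvPolynomial (Fin C.n) O)[X]) : C.E₀ ε :=
  Polynomial.aeval (C.W ε) ((Polydisc.zpoly (C.πO ^ ε.jz) Ψ).comp (C.lin ε))

/-- `evalE` is a ring homomorphism: multiplicativity. [folklore] -/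
theorem evalE_mul (Ψ Ψ' : (MvPolynomial (Fin C.n) O)[X]) :
    C.evalE ε (Ψ * Ψ') = C.evalE ε Ψ * C.evalE ε Ψ' := by
  simp only [evalE, Polydisc.zpoly, Polynomial.map_mul, Polynomial.mul_comp, map_mul]

/-- `F̃(W) = 0` in `E₀`. [folklore] -/
theorem aeval_W_Ft : Polynomial.aeval (C.W ε) (C.Ft ε) = 0 := (C.PE ε).hasMap_X.1

/-- The localized polynomial is a unit at `W`. [folklore] -/
theorem isUnit_aeval_W_g : IsUnit (Polynomial.aeval (C.W ε)
    (derivative (C.Ft ε) * ((C.Ft ε).divX * C.Gt ε * C.gU ε))) := (C.PE ε).hasMap_X.2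

/-- `(F̃ − F̃₀)/W` is a unit at `W`. [folklore] -/
theorem isUnit_aeval_W_divX : IsUnit (Polynomial.aeval (C.W ε) (C.Ft ε).divX) := by
  have h := C.isUnit_aeval_W_g ε
  simp only [map_mul] at h
  exact isUnit_of_mul_isUnit_left (isUnit_of_mul_isUnit_left (isUnit_of_mul_isUnit_right h))

/-- `Ğ(W)` is a unit. [folklore] -/
theorem isUnit_aeval_W_Gt : IsUnit (Polynomial.aeval (C.W ε) (C.Gt ε)) := by
  have h := C.isUnit_aeval_W_g ε
  simp only [map_mul] at h
  exact isUnit_of_mul_isUnit_right (isUnit_of_mul_isUnit_left (isUnit_of_mul_isUnit_right h))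

/-- `∏ Ž_z (W)` is a unit. [folklore] -/
theorem isUnit_aeval_W_gU : IsUnit (Polynomial.aeval (C.W ε) (C.gU ε)) := by
  have h := C.isUnit_aeval_W_g ε
  simp only [map_mul] at h
  exact isUnit_of_mul_isUnit_right (isUnit_of_mul_isUnit_right h)

/-- Each built-in `Ž_z(W)`, `z ∈ U`, is a unit. [folklore] -/
theorem isUnit_aeval_W_Zt {z : C.Rh} (hzU : z ∈ ε.U) :
    IsUnit (Polynomial.aeval (C.W ε) (C.Zt ε z (ε.hUO z hzU))) := by
  have h := C.isUnit_aeval_W_gU ε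
  rw [gU, map_list_prod, List.map_map] at h
  have hmem : (⟨z, hzU⟩ : {z // z ∈ ε.U}) ∈ ε.U.attach := List.mem_attach _ _
  exact isUnit_of_dvd_unit (List.dvd_prod (List.mem_map.mpr ⟨⟨z, hzU⟩, hmem, rfl⟩)) h

/-- `F_O(π^{j_z}u′, w₀′ + c₀′π^r W) = 0` in `E₀`. [folklore] -/
theorem evalE_FO : C.evalE ε C.FO = 0 := by
  have h := congrArg (Polynomial.aeval (C.W ε)) (C.Ft_spec ε)
  rw [map_mul, Polynomial.aeval_C, C.aeval_W_Ft ε, mul_zero] at h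
  exact h.symm

/-- `C(π^{N_g}) Ğ(W) = C κ₀ · G_O(…)(W)`. [folklore] -/
theorem Gt_spec_W : algebraMap (MvPolynomial (Fin C.n) O) (C.E₀ ε) (MvPolynomial.C (C.πO ^ C.Ng)) *
    Polynomial.aeval (C.W ε) (C.Gt ε) =
    algebraMap (MvPolynomial (Fin C.n) O) (C.E₀ ε) (MvPolynomial.C C.κ₀O) * C.evalE ε C.GO := by
  have h := congrArg (Polynomial.aeval (C.W ε)) (C.Gt_spec ε)
  rwa [map_mul, Polynomial.aeval_C, map_mul, Polynomial.aeval_C] at h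

/-- `C(π^{b_z}) Ž_z(W) = C(κ₀^N π^{N a_G}) · Φ_{z,O}(…)(W)`. [folklore] -/
theorem Zt_spec_W (z : C.Rh) (hz : C.φh z ∈ O) (hb : C.repb z ≤ ε.r) :
    algebraMap (MvPolynomial (Fin C.n) O) (C.E₀ ε) (MvPolynomial.C (C.πO ^ C.repb z)) *
      Polynomial.aeval (C.W ε) (C.Zt ε z hz) =
    algebraMap (MvPolynomial (Fin C.n) O) (C.E₀ ε)
      (MvPolynomial.C (C.κ₀O ^ C.repN z * C.πO ^ (C.repN z * C.aG))) *
      C.evalE ε (C.repΦO z) := by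
  have h := congrArg (Polynomial.aeval (C.W ε)) (C.Zt_spec ε z hz hb)
  rwa [map_mul, Polynomial.aeval_C, map_mul, Polynomial.aeval_C] at h

/-! ### The `m°`-point of the chart -/

/-- `m°[X₁,…,X_n] → m°`, `Xᵢ ↦ 0`: the algebra structure of the point. [folklore] -/
abbrev algPt : Algebra (MvPolynomial (Fin C.n) O) O :=
  (MvPolynomial.constantCoeff : MvPolynomial (Fin C.n) O →+* O).toAlgebra

/-- Under the point structure, `aeval 0 Ψ = Ψ₀(0)`. [folklore] -/
theorem aeval_pt (Ψ : (MvPolynomial (Fin C.n) O)[X]) : letI := C.algPt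
    Polynomial.aeval (0 : O) Ψ = MvPolynomial.constantCoeff (Ψ.coeff 0) := by
  letI := C.algPt
  rw [Polynomial.aeval_def, Polynomial.eval₂_at_zero]; rfl

/-- `ρ₀(0) = 0`. [folklore] -/
theorem constantCoeff_ρ₀ : MvPolynomial.constantCoeff (Polydisc.ρ₀ C.FO C.w₀'O C.πO ε.jz) = 0 :=
  C.pow_πO_mul_eq_zero (Polydisc.pow_mul_constantCoeff_ρ₀ C.FO C.w₀'O C.πO ε.jz)

/-- `ρ₁(0) = 0`. [folklore] -/
theorem constantCoeff_ρ₁ : MvPolynomial.constantCoeff (Polydisc.ρ₁ C.FO C.w₀'O C.πO ε.jz) = 0 :=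
  C.pow_πO_mul_eq_zero (Polydisc.pow_mul_constantCoeff_ρ₁ C.FO C.w₀'O C.πO ε.jz)

/-- `σ₀(0) = 0` for any numerator. [folklore] -/
theorem constantCoeff_σ₀ (Ψ : (MvPolynomial (Fin C.n) O)[X]) :
    MvPolynomial.constantCoeff (Polydisc.σ₀ Ψ C.w₀'O C.πO ε.jz) = 0 :=
  C.pow_πO_mul_eq_zero (Polydisc.pow_mul_constantCoeff_σ₀ Ψ C.w₀'O C.πO ε.jz)

/-- `F̃(0, 0) = 0`. [folklore] -/
theorem aeval_pt_Ft : letI := C.algPt; Polynomial.aeval (0 : O) (C.Ft ε) = 0 := by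
  rw [C.aeval_pt, Ft, Polydisc.Ftilde_coeff_zero, map_mul, MvPolynomial.constantCoeff_C,
    C.constantCoeff_ρ₀, mul_zero]

/-- `F̃₁(0) = 1`. [folklore] -/
theorem constantCoeff_Ft_coeff_one : MvPolynomial.constantCoeff ((C.Ft ε).coeff 1) = 1 := by
  rw [Ft, Polydisc.Ftilde_coeff_one, map_add, map_one, map_mul, MvPolynomial.constantCoeff_C,
    C.constantCoeff_ρ₁, mul_zero, add_zero]

/-- `F̃′(0, 0) = 1`. [folklore] -/
theorem aeval_pt_derivative_Ft : letI := C.algPt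
    Polynomial.aeval (0 : O) (derivative (C.Ft ε)) = 1 := by
  rw [C.aeval_pt, Polynomial.coeff_derivative, zero_add, Nat.cast_zero, zero_add, mul_one,
    C.constantCoeff_Ft_coeff_one]

/-- `((F̃ − F̃₀)/W)(0, 0) = 1`. [folklore] -/
theorem aeval_pt_divX_Ft : letI := C.algPt
    Polynomial.aeval (0 : O) (C.Ft ε).divX = 1 := by
  rw [C.aeval_pt, Polynomial.coeff_divX, zero_add, C.constantCoeff_Ft_coeff_one]

/-- `Ž_z(0, 0) = z(x)`. [folklore] -/
theorem aeval_pt_Zt (z : C.Rh) (hz : C.φh z ∈ O) : letI := C.algPt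
    Polynomial.aeval (0 : O) (C.Zt ε z hz) = ⟨C.φh z, hz⟩ := by
  rw [C.aeval_pt, Zt, Polydisc.Ztilde_coeff_zero, map_add, map_mul, MvPolynomial.constantCoeff_C,
    MvPolynomial.constantCoeff_C, C.constantCoeff_σ₀, mul_zero, add_zero]

/-- `Ğ(0, 0) = 1`. [folklore] -/
theorem aeval_pt_Gt : letI := C.algPt
    Polynomial.aeval (0 : O) (C.Gt ε) = 1 := by
  rw [C.aeval_pt, Gt, Polydisc.Ztilde_coeff_zero, map_add, map_mul, MvPolynomial.constantCoeff_C,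
    MvPolynomial.constantCoeff_C, C.constantCoeff_σ₀, mul_zero, add_zero]

/-- `(∏ Ž_z)(0, 0)` is a unit. [folklore] -/
theorem isUnit_aeval_pt_gU : letI := C.algPt
    IsUnit (Polynomial.aeval (0 : O) (C.gU ε)) := by
  letI := C.algPt
  rw [gU, map_list_prod, List.map_map]
  refine List.prod_isUnit fun x hx => ?_
  obtain ⟨⟨z, hzU⟩, -, rfl⟩ := List.mem_map.mp hx
  simp only [Function.comp_apply]
  rw [C.aeval_pt_Zt]
  exact ε.hUunit z hzU

/-- **The `m°`-point of the polydisc chart**: `u′ ↦ 0, W ↦ 0`. [folklore] -/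
theorem hasMap_pt : letI := C.algPt; (C.PE ε).HasMap (0 : O) := by
  letI := C.algPt
  rw [PE, EtalePair.hasMap_ofDerivativeMul_iff]
  refine ⟨C.aeval_pt_Ft ε, ?_, ?_⟩
  · rw [C.aeval_pt_derivative_Ft]; exact isUnit_one
  · rw [map_mul, map_mul, C.aeval_pt_divX_Ft, C.aeval_pt_Gt, one_mul, one_mul]
    exact C.isUnit_aeval_pt_gU ε

/-- The `m°`-point `σ_E : E₀ → m°`. [folklore] -/
def σE : C.E₀ ε →+* O :=
  letI := C.algPt
  ((C.PE ε).lift (0 : O) (C.hasMap_pt ε)).toRingHom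

/-- `σ_E(W) = 0`. [folklore] -/
@[simp] theorem σE_W : C.σE ε (C.W ε) = 0 := by
  letI := C.algPt
  exact (C.PE ε).lift_X (0 : O) (C.hasMap_pt ε)

/-- `σ_E` on `m°[X]`: `Xᵢ ↦ 0`. [folklore] -/
@[simp] theorem σE_algebraMap (q : MvPolynomial (Fin C.n) O) :
    C.σE ε (algebraMap (MvPolynomial (Fin C.n) O) (C.E₀ ε) q) = MvPolynomial.constantCoeff q := by
  letI := C.algPt
  exact ((C.PE ε).lift (0 : O) (C.hasMap_pt ε)).commutes q

/-- `σ_E` on `m°`: the identity. [folklore] -/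
@[simp] theorem σE_algebraMap_O (a : O) : C.σE ε (algebraMap O (C.E₀ ε) a) = a := by
  rw [IsScalarTower.algebraMap_apply O (MvPolynomial (Fin C.n) O) (C.E₀ ε), σE_algebraMap,
    MvPolynomial.algebraMap_eq, MvPolynomial.constantCoeff_C]

/-- `σ_E` of a polynomial in `W`: its value at `(0, 0)`. [folklore] -/
theorem σE_aeval_W (Ψ : (MvPolynomial (Fin C.n) O)[X]) :
    C.σE ε (Polynomial.aeval (C.W ε) Ψ) = MvPolynomial.constantCoeff (Ψ.coeff 0) := by
  letI := C.algPt
  rw [σE, AlgHom.toRingHom_eq_coe, RingHom.coe_coe, ← Polynomial.aeval_algHom_apply,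
    (C.PE ε).lift_X, C.aeval_pt]

/-- The point `r_E ⊂ E₀` over the centre of `m°`. [folklore] -/
def rE : Ideal (C.E₀ ε) := (IsLocalRing.maximalIdeal O).comap (C.σE ε)

/-- `r_E` is prime. [folklore] -/
instance rE_isPrime : (C.rE ε).IsPrime := by unfold rE; exact Ideal.comap_isPrime _ _

end DecompChart

/-! ## The ambient ring `Ω_E = E₀ ⊗_{m°} m` and the map `ψ_E : Rh → Ω_E` -/

namespace DecompChart

variable {V : ValuationSubring k} {O : ValuationSubring m} {A : Subring K}
  {φ : Algebra.adjoin k (A : Set K) →ₐ[k] m} (C : DecompChart V O A φ) (ε : C.EParams)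

/-- The ambient ring `Ω_E = E₀ ⊗_{m°} m` (an `m`-algebra containing `E₀`). [folklore] -/
abbrev ΩE : Type u := TensorProduct O (C.E₀ ε) m

/-- `ι_E : E₀ → Ω_E`. [folklore] -/
abbrev ιE : C.E₀ ε →ₐ[O] C.ΩE ε := Algebra.TensorProduct.includeLeft

/-- `ι_m : m → Ω_E`. [folklore] -/
abbrev ιm : m →ₐ[O] C.ΩE ε := Algebra.TensorProduct.includeRight

/-- `ι_E` is injective (`E₀` is flat over the domain `m°`). [folklore] -/
theorem ιE_injective : Function.Injective (C.ιE ε) :=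
  Algebra.TensorProduct.includeLeft_injective (S := O) Subtype.val_injective

/-- `ι_m(a) = ι_E(a)` for `a ∈ m°`. [folklore] -/
theorem ιm_coe (a : O) : C.ιm ε (a : m) = C.ιE ε (algebraMap O (C.E₀ ε) a) := by
  rw [show (a : m) = algebraMap O m a from rfl, AlgHom.commutes, AlgHom.commutes]

/-- `ι_m(a) = ι_E(C a)` for `a ∈ m°`, through `m°[X]`. [folklore] -/
theorem ιm_coe' (a : O) : C.ιm ε (a : m) =
    C.ιE ε (algebraMap (MvPolynomial (Fin C.n) O) (C.E₀ ε) (MvPolynomial.C a)) := by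
  rw [ιm_coe, IsScalarTower.algebraMap_apply O (MvPolynomial (Fin C.n) O) (C.E₀ ε),
    MvPolynomial.algebraMap_eq]

/-- Nonzero elements of `m` are units of `Ω_E`. [folklore] -/
theorem isUnit_ιm {a : m} (ha : a ≠ 0) : IsUnit (C.ιm ε a) := (IsUnit.mk0 a ha).map _

/-- `ι_m(π^N)` is a unit. [folklore] -/
theorem isUnit_ιm_π_pow (N : ℕ) : IsUnit (C.ιm ε (algebraMap k m C.π ^ N)) :=
  C.isUnit_ιm ε (pow_ne_zero _ ((_root_.map_ne_zero _).mpr C.hπ0))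

/-- **The coordinate structure `k[X₁,…,X_n] → Ω_E`**: constants through `k → m`, and
`Xᵢ ↦ π^{j_z} u′ᵢ` (the polydisc zoom). [folklore] -/
def βE : MvPolynomial (Fin C.n) k →+* C.ΩE ε :=
  MvPolynomial.eval₂Hom ((C.ιm ε : m →+* C.ΩE ε).comp (algebraMap k m))
    fun i => C.ιE ε (algebraMap (MvPolynomial (Fin C.n) O) (C.E₀ ε)
      (MvPolynomial.C (C.πO ^ ε.jz) * MvPolynomial.X i))

/-- `Ω_E` as a `k[X₁,…,X_n]`-algebra through `βE`. [folklore] -/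
instance algBΩ : Algebra (MvPolynomial (Fin C.n) k) (C.ΩE ε) := (C.βE ε).toAlgebra

/-- The structure map of `Ω_E` over `k[X]` is `βE`. [folklore] -/
theorem algebraMap_BΩ : algebraMap (MvPolynomial (Fin C.n) k) (C.ΩE ε) = C.βE ε := rfl

/-- `βE` on constants. [folklore] -/
@[simp] theorem βE_C (c : k) : C.βE ε (MvPolynomial.C c) = C.ιm ε (algebraMap k m c) :=
  MvPolynomial.eval₂Hom_C _ _ c

/-- `βE` on variables. [folklore] -/
@[simp] theorem βE_X (i : Fin C.n) : C.βE ε (MvPolynomial.X i) =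
    C.ιE ε (algebraMap (MvPolynomial (Fin C.n) O) (C.E₀ ε)
      (MvPolynomial.C (C.πO ^ ε.jz) * MvPolynomial.X i)) :=
  MvPolynomial.eval₂Hom_X' _ _ i

/-- The compatibility of the coordinate structures: on `k°`-polynomials, `βE` is
`ι_E ∘ (m°[X] → E₀) ∘ zoomX(π^{j_z}) ∘ (k° → m°)`. [folklore] -/
theorem βE_comp_map : (C.βE ε).comp (MvPolynomial.map (algebraMap V k)) =
    ((C.ιE ε : C.E₀ ε →+* C.ΩE ε).comp (algebraMap (MvPolynomial (Fin C.n) O) (C.E₀ ε))).comp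
      ((Polydisc.zoomX (C.πO ^ ε.jz)).toRingHom.comp (MvPolynomial.map C.vO)) := by
  refine MvPolynomial.ringHom_ext (fun v => ?_) (fun i => ?_)
  · simp only [RingHom.coe_comp, Function.comp_apply, MvPolynomial.map_C, βE_C,
      AlgHom.toRingHom_eq_coe, RingHom.coe_coe, Polydisc.zoomX_C]
    rw [← C.ιm_coe' ε]; rfl
  · simp only [RingHom.coe_comp, Function.comp_apply, MvPolynomial.map_X, βE_X,
      AlgHom.toRingHom_eq_coe, RingHom.coe_coe, Polydisc.zoomX_X]

/-- The Newton point `W̃ = w₀′ + c₀′π^r W ∈ E₀`. [folklore] -/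
def WE : C.E₀ ε := Polynomial.aeval (C.W ε) (C.lin ε)

/-- `aeval W̃ Ψ = aeval W (Ψ ∘ lin)`. [folklore] -/
theorem aeval_WE (Ψ : (MvPolynomial (Fin C.n) O)[X]) :
    Polynomial.aeval (C.WE ε) Ψ = Polynomial.aeval (C.W ε) (Ψ.comp (C.lin ε)) := by
  rw [WE, Polynomial.aeval_comp]

/-- `w′_E = ι_E(W̃) ∈ Ω_E` — the image of `w′`. [folklore] -/
def w'E : C.ΩE ε := C.ιE ε (C.WE ε)

/-- `x_E = π^{−d} w′_E` — the image of the generator `w = P.x`. [folklore] -/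
def xE : C.ΩE ε := C.ιm ε ((algebraMap k m C.π ^ C.dW)⁻¹) * C.w'E ε

/-- `π^d x_E = w′_E`, with the scalar through `k[X]`. [folklore] -/
theorem scale_xE : C.βE ε (MvPolynomial.C (C.π ^ C.dW)) * C.xE ε = C.w'E ε := by
  rw [βE_C, xE, ← mul_assoc, map_pow, ← map_mul,
    mul_inv_cancel₀ (pow_ne_zero _ ((_root_.map_ne_zero _).mpr C.hπ0)), map_one, one_mul]

/-- **The evaluation chain**: for `Ψ_V` over `k°`,
`aeval w′_E Ψ_k = ι_E(Ψ_O(π^{j_z}u′, w₀′ + c₀′π^r W))`. [folklore] -/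
theorem aeval_w'E_map (ΨV : (MvPolynomial (Fin C.n) V)[X]) :
    Polynomial.aeval (C.w'E ε) (ΨV.map (MvPolynomial.map (algebraMap V k))) =
      C.ιE ε (C.evalE ε (ΨV.map (MvPolynomial.map C.vO))) := by
  rw [Polynomial.aeval_def, algebraMap_BΩ,
    Polynomial.eval₂_map, C.βE_comp_map ε, RingHom.comp_assoc, w'E,
    show (C.ιE ε) (C.WE ε) = (C.ιE ε : C.E₀ ε →+* C.ΩE ε) (C.WE ε) from rfl, ← Polynomial.hom_eval₂,
    ← Polynomial.eval₂_map, ← Polynomial.map_map]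
  change C.ιE ε (Polynomial.aeval (C.WE ε) _) = _
  rw [C.aeval_WE ε, evalE, Polydisc.zpoly]

/-- `F(x_E) = 0` in `Ω_E`. [folklore] -/
theorem aeval_xE_f : Polynomial.aeval (C.xE ε) C.P.f = 0 := by
  have h := Polydisc.aeval_scaleW (S := C.ΩE ε) C.hπ0 C.dW C.aF C.P.f (C.xE ε)
  rw [algebraMap_BΩ, C.scale_xE ε, ← F₁, ← C.map_FV, C.aeval_w'E_map ε, ← FO, C.evalE_FO ε,
    map_zero, βE_C, map_pow] at h
  exact (C.isUnit_ιm_π_pow ε C.aF).mul_right_eq_zero.mp h.symm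

/-- `ι_E(G_O(…)(W))` is a unit of `Ω_E`. [folklore] -/
theorem isUnit_ιE_evalE_GO : IsUnit (C.ιE ε (C.evalE ε C.GO)) := by
  have h := congrArg (C.ιE ε) (C.Gt_spec_W ε)
  rw [map_mul, map_mul, ← C.ιm_coe' ε, ← C.ιm_coe' ε] at h
  have hu : IsUnit (C.ιm ε (C.πO ^ C.Ng : O) * C.ιE ε (Polynomial.aeval (C.W ε) (C.Gt ε))) :=
    IsUnit.mul (by rw [SubmonoidClass.coe_pow, coe_πO]; exact C.isUnit_ιm_π_pow ε _)
      ((C.isUnit_aeval_W_Gt ε).map _)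
  rw [h] at hu
  exact isUnit_of_mul_isUnit_right hu

/-- `G(x_E)` is a unit of `Ω_E`. [folklore] -/
theorem isUnit_aeval_xE_g : IsUnit (Polynomial.aeval (C.xE ε) C.P.g) := by
  have h := Polydisc.aeval_scaleW (S := C.ΩE ε) C.hπ0 C.dW C.aG C.P.g (C.xE ε)
  rw [algebraMap_BΩ, C.scale_xE ε, ← G₁, ← C.map_GV, C.aeval_w'E_map ε, ← GO] at h
  have hu := C.isUnit_ιE_evalE_GO ε
  rw [h] at hu
  exact isUnit_of_mul_isUnit_right hu

/-- **`x_E` is a point of the standard étale presentation of `Rh` in `Ω_E`.** [folklore] -/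
theorem hasMap_xE : C.P.HasMap (C.xE ε) := ⟨C.aeval_xE_f ε, C.isUnit_aeval_xE_g ε⟩

/-- **`ψ_E : Rh → Ω_E`** — the `K`-side of the polydisc chart: `k[X₁,…,X_n]`-algebra map with
`Tᵢ ↦ π^{j_z} u′ᵢ`, `w ↦ x_E`. [folklore] -/
def ψE : C.Rh →ₐ[MvPolynomial (Fin C.n) k] C.ΩE ε :=
  (C.P.lift (C.xE ε) (C.hasMap_xE ε)).comp C.P.equivRing.toAlgHom

/-- `ψ_E(w) = x_E`. [folklore] -/
@[simp] theorem ψE_x : C.ψE ε C.P.x = C.xE ε := by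
  change (C.P.lift (C.xE ε) (C.hasMap_xE ε)) (C.P.equivRing C.P.x) = _
  rw [StandardEtalePresentation.equivRing_x, StandardEtalePair.lift_X]

/-- `ψ_E` on `k[X₁,…,X_n]`. [folklore] -/
@[simp] theorem ψE_algebraMap (q : MvPolynomial (Fin C.n) k) :
    C.ψE ε (algebraMap (MvPolynomial (Fin C.n) k) C.Rh q) = C.βE ε q := (C.ψE ε).commutes q

/-- `ψ_E` on `k`. [folklore] -/
@[simp] theorem ψE_algebraMap_k (c : k) :
    C.ψE ε (algebraMap k C.Rh c) = C.ιm ε (algebraMap k m c) := by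
  rw [IsScalarTower.algebraMap_apply k (MvPolynomial (Fin C.n) k) C.Rh, ψE_algebraMap,
    MvPolynomial.algebraMap_eq, βE_C]

/-- `ψ_E(Tᵢ) = π^{j_z} u′ᵢ`. [folklore] -/
theorem ψE_Tsub (i : Fin C.n) : C.ψE ε (C.Tsub i) =
    C.ιE ε (algebraMap (MvPolynomial (Fin C.n) O) (C.E₀ ε)
      (MvPolynomial.C (C.πO ^ ε.jz) * MvPolynomial.X i)) := by
  rw [← C.algebraMap_X', ψE_algebraMap, βE_X]

/-- `ψ_E(w′) = w′_E`. [folklore] -/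
@[simp] theorem ψE_w' : C.ψE ε C.w' = C.w'E ε := by
  rw [w'_eq, map_mul, ψE_algebraMap, ψE_x, C.scale_xE ε]

/-- `ψ_E` of a `k°`-integral polynomial in `w′`: the evaluation chain. [folklore] -/
theorem ψE_aeval_w' (ΨV : (MvPolynomial (Fin C.n) V)[X]) :
    C.ψE ε (Polynomial.aeval C.w' (ΨV.map (MvPolynomial.map (algebraMap V k)))) =
      C.ιE ε (C.evalE ε (ΨV.map (MvPolynomial.map C.vO))) := by
  rw [← Polynomial.aeval_algHom_apply, ψE_w', C.aeval_w'E_map ε]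

/-! ### Honest preimages: `ψ_E(z) = ι_E(Ž_z(W) · Ğ(W)^{−N_z})` -/

/-- The unit `Ğ(W)`. [folklore] -/
def GtWu : (C.E₀ ε)ˣ := (C.isUnit_aeval_W_Gt ε).unit

/-- `↑GtWu = Ğ(W)`. [folklore] -/
@[simp] theorem coe_GtWu : (C.GtWu ε : C.E₀ ε) = Polynomial.aeval (C.W ε) (C.Gt ε) := rfl

/-- **The honest preimage** `zE z = Ž_z(W) · Ğ(W)^{−N_z} ∈ E₀` of `ψ_E(z)`, for `z ∈ Rh` with
`z(x) ∈ m°`. [folklore] -/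
def zE (z : C.Rh) (hz : C.φh z ∈ O) : C.E₀ ε :=
  Polynomial.aeval (C.W ε) (C.Zt ε z hz) * ↑((C.GtWu ε)⁻¹ ^ C.repN z)

/-- **`ι_E(Ž_z(W)) = ψ_E(z) · ι_E(Ğ(W))^{N_z}`** (for `b_z ≤ r`). [folklore] -/
theorem ιE_aeval_W_Zt (z : C.Rh) (hz : C.φh z ∈ O) (hb : C.repb z ≤ ε.r) :
    C.ιE ε (Polynomial.aeval (C.W ε) (C.Zt ε z hz)) =
      C.ψE ε z * C.ιE ε (Polynomial.aeval (C.W ε) (C.Gt ε)) ^ C.repN z := by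
  -- the three equations
  have EQ1 := congrArg (C.ψE ε) (C.aeval_w'_repΦ₁ z)
  simp only [map_mul, map_pow, ψE_algebraMap_k] at EQ1
  rw [← C.map_repΦV, C.ψE_aeval_w' ε, ← repΦO, ← C.map_GV, C.ψE_aeval_w' ε, ← GO] at EQ1
  have EQ2 := congrArg (C.ιE ε) (C.Zt_spec_W ε z hz hb)
  rw [map_mul, map_mul, ← C.ιm_coe' ε, ← C.ιm_coe' ε] at EQ2
  have EQ3 := congrArg (C.ιE ε) (C.Gt_spec_W ε)
  rw [map_mul, map_mul, ← C.ιm_coe' ε, ← C.ιm_coe' ε] at EQ3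
  simp only [SubmonoidClass.coe_pow, MulMemClass.coe_mul, coe_πO, coe_κ₀O, map_pow, map_mul]
    at EQ2 EQ3
  have EQ3N := congrArg (fun x => x ^ C.repN z) EQ3
  simp only [mul_pow, ← pow_mul] at EQ3N
  -- abbreviations
  set p := C.ιm ε (algebraMap k m C.π) with hp
  set κ := C.ιm ε C.κ₀ with hκ
  set P := C.ιE ε (C.evalE ε (C.repΦO z))
  set Q := C.ιE ε (C.evalE ε C.GO)
  set Zw := C.ιE ε (Polynomial.aeval (C.W ε) (C.Zt ε z hz))
  set Gw := C.ιE ε (Polynomial.aeval (C.W ε) (C.Gt ε))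
  set s := C.ψE ε z
  have hb' : C.repb z = C.repa z + C.repN z * C.Ng := rfl
  have key : p ^ C.repb z * κ ^ C.repN z * Zw = p ^ C.repb z * κ ^ C.repN z * (s * Gw ^ C.repN z) := by
    rw [hb'] at EQ2 ⊢
    linear_combination κ ^ C.repN z * EQ2 + κ ^ (2 * C.repN z) * EQ1 -
      p ^ C.repa z * s * κ ^ C.repN z * EQ3N
  have hu : IsUnit (p ^ C.repb z * κ ^ C.repN z) :=
    IsUnit.mul ((C.isUnit_ιm ε ((_root_.map_ne_zero _).mpr C.hπ0)).pow _)
      ((C.isUnit_ιm ε (fun h0 => C.κ₀O_ne_zero (Subtype.ext h0))).pow _)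
  exact hu.mul_left_cancel key

/-- **`ι_E(zE z) = ψ_E(z)`.** [folklore] -/
theorem ιE_zE (z : C.Rh) (hz : C.φh z ∈ O) (hb : C.repb z ≤ ε.r) :
    C.ιE ε (C.zE ε z hz) = C.ψE ε z := by
  rw [zE, Units.val_pow_eq_pow_val, map_mul, map_pow, C.ιE_aeval_W_Zt ε z hz hb, mul_assoc,
    ← mul_pow, ← map_mul, ← coe_GtWu, Units.mul_inv, map_one, one_pow, mul_one]

/-- `σ_E(Ğ(W)) = 1`. [folklore] -/
theorem σE_GtW : C.σE ε (Polynomial.aeval (C.W ε) (C.Gt ε)) = 1 := by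
  rw [C.σE_aeval_W, Gt, Polydisc.Ztilde_coeff_zero, map_add, map_mul, MvPolynomial.constantCoeff_C,
    MvPolynomial.constantCoeff_C, C.constantCoeff_σ₀, mul_zero, add_zero]

/-- `σ_E(Ğ(W)⁻¹) = 1`. [folklore] -/
theorem σE_GtWu_inv : C.σE ε ↑((C.GtWu ε)⁻¹) = 1 := by
  have h : C.σE ε ↑((C.GtWu ε)⁻¹) * C.σE ε (C.GtWu ε) = 1 := by
    rw [← map_mul, Units.inv_mul, map_one]
  rwa [coe_GtWu, σE_GtW, mul_one] at h

/-- **`σ_E(zE z) = z(x)`** — the built-in preimages have the right value at the point. [folklore] -/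
theorem σE_zE (z : C.Rh) (hz : C.φh z ∈ O) : C.σE ε (C.zE ε z hz) = ⟨C.φh z, hz⟩ := by
  rw [zE, Units.val_pow_eq_pow_val, map_mul, map_pow, σE_GtWu_inv, one_pow, mul_one,
    C.σE_aeval_W, Zt,
    Polydisc.Ztilde_coeff_zero, map_add, map_mul, MvPolynomial.constantCoeff_C,
    MvPolynomial.constantCoeff_C, C.constantCoeff_σ₀, mul_zero, add_zero]

/-- For `z ∈ U`, `zE z` is a unit of `E₀`. [folklore] -/
theorem isUnit_zE {z : C.Rh} (hzU : z ∈ ε.U) : IsUnit (C.zE ε z (ε.hUO z hzU)) :=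
  IsUnit.mul (C.isUnit_aeval_W_Zt ε hzU) (Units.isUnit _)

/-! ### Smallness in the polydisc chart -/

/-- **`W` is small**: `W ∈ π^M E₀`, `M = j_z − r − 2N₀` (from `F̃(W) = 0`: `W · ((F̃−F̃₀)/W)(W) =
−F̃₀`). [folklore] -/
theorem W_small : ∃ x : C.E₀ ε, C.W ε = algebraMap O (C.E₀ ε) (C.πO ^ ε.M) * x := by
  have key := congrArg (Polynomial.aeval (C.W ε)) (Polynomial.X_mul_divX_add (C.Ft ε))
  rw [C.aeval_W_Ft ε, map_add, map_mul, Polynomial.aeval_X, Polynomial.aeval_C, Ft,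
    Polydisc.Ftilde_coeff_zero, ← Ft] at key
  obtain ⟨v, hv⟩ := C.isUnit_aeval_W_divX ε
  refine ⟨-(algebraMap (MvPolynomial (Fin C.n) O) (C.E₀ ε)
    (MvPolynomial.C (C.ι₀O ^ 2) * Polydisc.ρ₀ C.FO C.w₀'O C.πO ε.jz) * ↑(v⁻¹)), ?_⟩
  have hW : C.W ε = -(algebraMap (MvPolynomial (Fin C.n) O) (C.E₀ ε)
      (MvPolynomial.C (C.πO ^ (ε.jz - ε.r - 2 * C.N₀) * C.ι₀O ^ 2) *
        Polydisc.ρ₀ C.FO C.w₀'O C.πO ε.jz)) * ↑(v⁻¹) := by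
    have := eq_neg_of_add_eq_zero_left key
    rw [← hv] at this
    rw [← this, mul_assoc, Units.mul_inv, mul_one]
  rw [hW, EParams.M, IsScalarTower.algebraMap_apply O (MvPolynomial (Fin C.n) O) (C.E₀ ε),
    MvPolynomial.algebraMap_eq, map_mul, map_mul, map_mul, map_mul]
  ring

/-- Sets of the form `c + π^M E₀` are closed under multiplication by `1 + π^M E₀`. [folklore] -/
theorem small_mul {a c e e' : C.E₀ ε} (he : ∃ x, e = c + a * x) (he' : ∃ y, e' = 1 + a * y) :
    ∃ w, e * e' = c + a * w := by
  obtain ⟨x, rfl⟩ := he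
  obtain ⟨y, rfl⟩ := he'
  exact ⟨x + c * y + a * x * y, by ring⟩

/-- … and by powers of such. [folklore] -/
theorem small_mul_pow {a c e e' : C.E₀ ε} (he : ∃ x, e = c + a * x) (he' : ∃ y, e' = 1 + a * y)
    (N : ℕ) : ∃ w, e * e' ^ N = c + a * w := by
  induction N with
  | zero => simpa using he
  | succ N ih => rw [pow_succ, ← mul_assoc]; exact C.small_mul ε ih he'

/-- The inverse of a unit in `1 + π^M E₀` lies in `1 + π^M E₀`. [folklore] -/
theorem small_inv {a : C.E₀ ε} {u : (C.E₀ ε)ˣ} (hu : ∃ x, (u : C.E₀ ε) = 1 + a * x) :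
    ∃ y, (↑(u⁻¹) : C.E₀ ε) = 1 + a * y := by
  obtain ⟨x, hx⟩ := hu
  refine ⟨-(x * ↑(u⁻¹)), ?_⟩
  have h1 : (↑(u⁻¹) : C.E₀ ε) * (1 + a * x) = 1 := by rw [← hx, Units.inv_mul]
  linear_combination h1

/-- **`Ž_z(W) ∈ z(x) + π^M E₀`** for `b_z ≤ r`. [folklore] -/
theorem Zt_small (z : C.Rh) (hz : C.φh z ∈ O) (hb : C.repb z ≤ ε.r) :
    ∃ x : C.E₀ ε, Polynomial.aeval (C.W ε) (C.Zt ε z hz) =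
      algebraMap O (C.E₀ ε) ⟨C.φh z, hz⟩ + algebraMap O (C.E₀ ε) (C.πO ^ ε.M) * x := by
  obtain ⟨xW, hxW⟩ := C.W_small ε
  have hjz := ε.hjz
  obtain ⟨d, hd⟩ : ∃ d, ε.jz - C.repb z = ε.M + d := ⟨ε.r + 2 * C.N₀ - C.repb z, by
    rw [EParams.M]; omega⟩
  refine ⟨algebraMap (MvPolynomial (Fin C.n) O) (C.E₀ ε) (MvPolynomial.C (C.πO ^ d *
      (C.κ₀O ^ C.repN z * C.πO ^ (C.repN z * C.aG))) * Polydisc.σ₀ (C.repΦO z) C.w₀'O C.πO ε.jz) +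
    algebraMap (MvPolynomial (Fin C.n) O) (C.E₀ ε) (MvPolynomial.C (C.c₀' * C.πO ^ (ε.r - C.repb z) *
      (C.κ₀O ^ C.repN z * C.πO ^ (C.repN z * C.aG)))) * xW *
      Polynomial.aeval (C.W ε) (((Polydisc.ztaylor (C.πO ^ ε.jz) (C.repΦO z) C.w₀'O).divX).comp
        (Polynomial.C (MvPolynomial.C (C.c₀' * C.πO ^ ε.r)) * X)), ?_⟩
  rw [Zt, Polydisc.Ztilde, hd]
  simp only [map_add, map_mul, map_pow, Polynomial.aeval_C, Polynomial.aeval_X]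
  rw [hxW]
  simp only [IsScalarTower.algebraMap_apply O (MvPolynomial (Fin C.n) O) (C.E₀ ε),
    MvPolynomial.algebraMap_eq, map_pow]
  ring

/-- `Ğ(W) ∈ 1 + π^M E₀`. [folklore] -/
theorem Gt_small : ∃ x : C.E₀ ε, Polynomial.aeval (C.W ε) (C.Gt ε) =
    1 + algebraMap O (C.E₀ ε) (C.πO ^ ε.M) * x := by
  obtain ⟨xW, hxW⟩ := C.W_small ε
  have hjz := ε.hjz
  have hNg := ε.hNg
  obtain ⟨d, hd⟩ : ∃ d, ε.jz - C.Ng = ε.M + d := ⟨ε.r + 2 * C.N₀ - C.Ng, by rw [EParams.M]; omega⟩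
  refine ⟨algebraMap (MvPolynomial (Fin C.n) O) (C.E₀ ε) (MvPolynomial.C (C.πO ^ d * C.κ₀O) *
      Polydisc.σ₀ C.GO C.w₀'O C.πO ε.jz) +
    algebraMap (MvPolynomial (Fin C.n) O) (C.E₀ ε) (MvPolynomial.C (C.c₀' * C.πO ^ (ε.r - C.Ng) *
      C.κ₀O)) * xW *
      Polynomial.aeval (C.W ε) (((Polydisc.ztaylor (C.πO ^ ε.jz) C.GO C.w₀'O).divX).comp
        (Polynomial.C (MvPolynomial.C (C.c₀' * C.πO ^ ε.r)) * X)), ?_⟩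
  rw [Gt, Polydisc.Ztilde, hd]
  simp only [map_add, map_mul, map_pow, map_one, Polynomial.aeval_C, Polynomial.aeval_X]
  rw [hxW]
  simp only [IsScalarTower.algebraMap_apply O (MvPolynomial (Fin C.n) O) (C.E₀ ε),
    MvPolynomial.algebraMap_eq, map_pow]
  ring

/-- **`zE z ∈ z(x) + π^M E₀`** for `b_z ≤ r`. [folklore] -/
theorem zE_small (z : C.Rh) (hz : C.φh z ∈ O) (hb : C.repb z ≤ ε.r) :
    ∃ x : C.E₀ ε, C.zE ε z hz =
      algebraMap O (C.E₀ ε) ⟨C.φh z, hz⟩ + algebraMap O (C.E₀ ε) (C.πO ^ ε.M) * x := by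
  rw [zE, Units.val_pow_eq_pow_val]
  exact C.small_mul_pow ε (C.Zt_small ε z hz hb) (C.small_inv ε (C.Gt_small ε)) _

end DecompChart


end Literature.AlgebraicGeometry.Resolution
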